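/-
Origin: expansion seat `planner-pub-hodgecm-pv10-g4-0`, handover #13 2026-08-18T13:33:29Z ; rewrite: ^import Pv10g4\.StagesCovering -> import HodgeCM.PerL34.StagesCovering (`HOME/pub-hodgecm-pv10-g4/lean/Pv10g4/BallCovering.lean`, md5 592f8069, 215 lines);
landed by the gen-8 packager in gate run 30 as `HodgeCM/PerL34/BallCovering.lean` (import ^import Pv10g4\.StagesCovering[ \t]*$→import HodgeCM.PerL34.StagesCovering ×1; stripped 5 #print/#check/#eval lines).
-/
/-
Origin: HOME/pub-hodgecm-pv10-g4/lean/Pv10g4/BallCovering.lean (WIP module `Pv10g4.BallCovering`;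
intended final place `HodgeCM/PerL34/BallCovering.lean` = module `HodgeCM.PerL34.BallCovering`)
(import rewrite on landing: `import Pv10g4.StagesCovering` ↦ `import HodgeCM.PerL34.StagesCovering`; the other
import is a tree module and stays).
-/
import Summits.HodgeConjecture.HodgeCM.PerL34.ShimuraSetBall
import Summits.HodgeConjecture.HodgeCM.PerL34.StagesCovering

/-!
# `Γ₁' \ 𝔹² → Γ' \ 𝔹²` is a finite covering map (PerL v5 ll. 74–75 ON THE BALL; KERNEL)

PerL v5 §1.2, ll. 74–75: "for torsion-free `Γ`, `P^L_Γ := Γ\𝔹²` …, and there is a neat normal `K_1 ⊂ K_f` of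
finite index with `P^L_{Γ_1} → P^L_Γ` finite étale".  Row #12 (`StagesCovering`) proved the covering statement
for the pieces `Γ\Y`, `Y = G_U(ℝ)/C`; pv06-g5's tree files `ArchBall` / `ArchBallDiscrete` / `BallQuotient` /
`ShimuraSetBall` transport pieces to the BALL: `G_U(ℝ)/K_∞ ≃ₜ 𝔹²` equivariantly along the surjection
`archToU21 : G_U(ℝ) →* U(2,1)` (`quotientArchKHomeomorphBall`, `quotientArchKHomeomorphBall_smul`), images
`Γ' = archToU21(Γ)` of discrete `Γ` are discrete (`discreteTopology_map_archToU21`), `Γ'\𝔹²` is Hausdorff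
(`BallStabilizer.t2Space_ballQuotient_of_discrete`) and free actions stay free (`stabilizer_ball_eq_bot`).
This file puts the two together — the covering statement VERBATIM on quotients of `𝔹²`:

* §1 (groups): along any `f : G →* G'`, for `Γ₁ ≤ Γ ≤ G`: `(Γ₁.subgroupOf Γ).map (f.subgroupMap Γ) =
  (Γ₁.map f).subgroupOf (Γ.map f)`; hence `Γ₁ ⊴ Γ ⇒ f(Γ₁) ⊴ f(Γ)` (relative normality), `[f(Γ) : f(Γ₁)] ∣ [Γ : Γ₁]`,
  finite index is preserved, and `[f(Γ) : f(Γ₁)] = [Γ : Γ₁]` when `Γ ⊓ ker f = ⊥`;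
* §2 (ball): for `Γ₁ ⊴ Γ ≤ G_U(ℝ)` of finite index, `Γ₁` discrete and `Γ` acting FREELY on `G_U(ℝ)/K_∞`:
  `Γ ⊓ ker (archToU21) = ⊥` (`inf_ker_archToU21_eq_bot`), and the map of ball quotients
  `Γ₁'\𝔹² → Γ'\𝔹²` is a **covering map** (`isCoveringMap_ballOrbitMap`) all of whose fibres have exactly
  `[Γ : Γ₁]` points (`natCard_fiber_ballOrbitMap`);
* §3 (PerL): for `G_U`, a Sylvester frame `T` at `w₁`, and a compact open level `K_f ≤ K_H(3)` (every
  `Γ_H(bK_fb⁻¹)` torsion-free, row #8): with the level `K₁` of row #9, for EVERY `b` the map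
  `Γ_H(bK₁b⁻¹)'\𝔹² → Γ_H(bK_fb⁻¹)'\𝔹²` is a covering map with fibres of cardinality
  `[Γ_H(bK_fb⁻¹) : Γ_H(bK₁b⁻¹)] ∣ [K_f : K₁]` — **`HodgeCM.HermSpace3.exists_ballPieces_isCoveringMap`**
  (Prop-record `BallPieceCovering`).

Kernel theorems over rows #4/#5/#7/#8/#9/#11/#12, pv06-g5's tree files and Mathlib only; nothing cited, nothing
posited; `#print axioms` = the standard trio.  NOT claimed: complex-analytic / algebraic "étale", projectivity,
anything about `P_K` as a variety.
-/

noncomputable section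

open scoped Matrix Pointwise
open MulAction Topology

namespace HodgeCM.PerL34.Godement.Stages

/-! ## §1  Relative normality and index along a homomorphism -/

section MapTransfer

variable {G G' : Type*} [Group G] [Group G'] (f : G →* G') (Γ₁ Γ : Subgroup G)

/-- `(Γ₁ ∩ Γ, seen in Γ)` maps onto `(f(Γ₁) ∩ f(Γ), seen in f(Γ))` under `f|_Γ : Γ →* f(Γ)` (for `Γ₁ ≤ Γ`). -/
theorem map_subgroupOf_subgroupMap (hle : Γ₁ ≤ Γ) :
    (Γ₁.subgroupOf Γ).map (f.subgroupMap Γ) = (Γ₁.map f).subgroupOf (Γ.map f) := by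
  ext x
  simp only [Subgroup.mem_map, Subgroup.mem_subgroupOf]
  constructor
  · rintro ⟨y, hy, rfl⟩
    exact ⟨(y : G), hy, rfl⟩
  · rintro ⟨z, hz, hzx⟩
    exact ⟨⟨z, hle hz⟩, hz, Subtype.ext hzx⟩

/-- Relative normality is preserved: `Γ₁ ⊴ Γ ⇒ f(Γ₁) ⊴ f(Γ)`. -/
theorem normal_subgroupOf_map (hle : Γ₁ ≤ Γ) [hN : (Γ₁.subgroupOf Γ).Normal] :
    ((Γ₁.map f).subgroupOf (Γ.map f)).Normal := by
  rw [← map_subgroupOf_subgroupMap f Γ₁ Γ hle]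
  exact hN.map _ (f.subgroupMap_surjective Γ)

/-- `[f(Γ) : f(Γ₁)] ∣ [Γ : Γ₁]`. -/
theorem relIndex_map_dvd (hle : Γ₁ ≤ Γ) : (Γ₁.map f).relIndex (Γ.map f) ∣ Γ₁.relIndex Γ := by
  rw [Subgroup.relIndex, Subgroup.relIndex, ← map_subgroupOf_subgroupMap f Γ₁ Γ hle]
  exact Subgroup.index_map_dvd _ (f.subgroupMap_surjective Γ)

/-- Finite relative index is preserved. -/
theorem finiteIndex_subgroupOf_map (hle : Γ₁ ≤ Γ) [hF : (Γ₁.subgroupOf Γ).FiniteIndex] :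
    ((Γ₁.map f).subgroupOf (Γ.map f)).FiniteIndex := by
  refine ⟨fun h0 => hF.index_ne_zero ?_⟩
  exact Nat.eq_zero_of_zero_dvd (h0 ▸ relIndex_map_dvd f Γ₁ Γ hle)

/-- If `Γ` meets `ker f` trivially then `[f(Γ) : f(Γ₁)] = [Γ : Γ₁]`. -/
theorem relIndex_map_eq (hle : Γ₁ ≤ Γ) (hker : Γ ⊓ f.ker = ⊥) :
    (Γ₁.map f).relIndex (Γ.map f) = Γ₁.relIndex Γ := by
  rw [Subgroup.relIndex, Subgroup.relIndex, ← map_subgroupOf_subgroupMap f Γ₁ Γ hle]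
  refine Subgroup.index_map_eq _ (f.subgroupMap_surjective Γ) ?_
  intro x hx
  have hx1 : (x : G) ∈ Γ ⊓ f.ker :=
    Subgroup.mem_inf.mpr ⟨x.2, MonoidHom.mem_ker.mpr (congrArg Subtype.val (MonoidHom.mem_ker.mp hx))⟩
  rw [hker, Subgroup.mem_bot] at hx1
  have hx0 : x = 1 := Subtype.ext hx1
  rw [hx0]
  exact one_mem _

end MapTransfer

end HodgeCM.PerL34.Godement.Stages

/-! ## §2  The ball: `Γ₁'\𝔹² → Γ'\𝔹²` is a covering map -/

namespace HodgeCM.PerL34.ArchCompactK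

section PerLBall

open HodgeCM.PerL34.Godement HodgeCM.PerL34.Godement.Stages HodgeCM.PerL34.AdelicUnitaryFactorisation
open Literature.AlgebraicGeometry.ShimuraVarieties (signatureMatrix)
open HodgeCM.PerL34.BallModel (U21 Ball x₀)
open NumberField

variable (L : CMField) {ι₁ : L →+* ℂ} (V : HermSpace3 L ι₁) {T : GL (Fin 3) ℂ}
  (hT : (T : Matrix (Fin 3) (Fin 3) ℂ)ᴴ * V.Hm.map (InfinitePlace.mk ι₁).embedding *
    (T : Matrix (Fin 3) (Fin 3) ℂ) = signatureMatrix 2)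

include hT

/-- A subgroup `Γ ≤ G_U(ℝ)` acting freely on `G_U(ℝ)/K_∞` meets `ker (G_U(ℝ) → U(2,1))` trivially. -/
theorem inf_ker_archToU21_eq_bot (Γ : Subgroup (Uinf L V.Hm))
    (hfree : ∀ q : Uinf L V.Hm ⧸ V.archK T, MulAction.stabilizer (Uinf L V.Hm) q ⊓ Γ = ⊥) :
    Γ ⊓ (V.archToU21 hT).ker = ⊥ := by
  rw [Subgroup.eq_bot_iff_forall]
  rintro γ ⟨hγ, hk⟩
  have hs : γ ∈ MulAction.stabilizer (Uinf L V.Hm) (QuotientGroup.mk 1 : Uinf L V.Hm ⧸ V.archK T) := by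
    rw [MulAction.mem_stabilizer_iff]
    apply (V.quotientArchKHomeomorphBall hT).injective
    rw [quotientArchKHomeomorphBall_smul, MonoidHom.mem_ker.mp hk, one_smul]
  have h1 : γ ∈ (⊥ : Subgroup (Uinf L V.Hm)) := by
    rw [← hfree (QuotientGroup.mk 1 : Uinf L V.Hm ⧸ V.archK T)]
    exact Subgroup.mem_inf.mpr ⟨hs, hγ⟩
  exact Subgroup.mem_bot.mp h1

/-- **Covering on the ball.** `Γ₁ ⊴ Γ ≤ G_U(ℝ)` of finite index, `Γ₁` discrete, `Γ` acting FREELY on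
`G_U(ℝ)/K_∞`: the map of ball quotients `Γ₁'\𝔹² → Γ'\𝔹²` (`Γ' = archToU21 (Γ)`) is a covering map. -/
theorem isCoveringMap_ballOrbitMap (Γ₁ Γ : Subgroup (Uinf L V.Hm)) [DiscreteTopology Γ₁]
    (hle : Γ₁ ≤ Γ) (hN : (Γ₁.subgroupOf Γ).Normal) (hFI : (Γ₁.subgroupOf Γ).FiniteIndex)
    (hfree : ∀ q : Uinf L V.Hm ⧸ V.archK T, MulAction.stabilizer (Uinf L V.Hm) q ⊓ Γ = ⊥) :
    IsCoveringMap (orbitMap (Γ₁.map (V.archToU21 hT)) (Γ.map (V.archToU21 hT)) (Subgroup.map_mono hle)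
      (X := Ball)) := by
  haveI := HodgeCM.HermSpace3.discreteTopology_map_archToU21 V hT Γ₁
  have hT2 : T2Space (orbitRel.Quotient (Γ₁.map (V.archToU21 hT)) Ball) :=
    BallStabilizer.t2Space_ballQuotient_of_discrete _
  exact @isCoveringMap_orbitMap U21 Ball _ _ _ _ _ _ (Subgroup.map_mono hle)
    (normal_subgroupOf_map (V.archToU21 hT) Γ₁ Γ hle) (finiteIndex_subgroupOf_map (V.archToU21 hT) Γ₁ Γ hle)
    hT2 (fun z => stabilizer_ball_eq_bot L V hT Γ hfree z)

/-- … with fibres of cardinality exactly `[Γ : Γ₁]`. -/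
theorem natCard_fiber_ballOrbitMap (Γ₁ Γ : Subgroup (Uinf L V.Hm)) [DiscreteTopology Γ₁]
    (hle : Γ₁ ≤ Γ) (hN : (Γ₁.subgroupOf Γ).Normal) (hFI : (Γ₁.subgroupOf Γ).FiniteIndex)
    (hfree : ∀ q : Uinf L V.Hm ⧸ V.archK T, MulAction.stabilizer (Uinf L V.Hm) q ⊓ Γ = ⊥)
    (p : orbitRel.Quotient (Γ.map (V.archToU21 hT)) Ball) :
    Nat.card (orbitMap (Γ₁.map (V.archToU21 hT)) (Γ.map (V.archToU21 hT)) (Subgroup.map_mono hle)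
      (X := Ball) ⁻¹' {p}) = Γ₁.relIndex Γ := by
  haveI := HodgeCM.HermSpace3.discreteTopology_map_archToU21 V hT Γ₁
  have hT2 : T2Space (orbitRel.Quotient (Γ₁.map (V.archToU21 hT)) Ball) :=
    BallStabilizer.t2Space_ballQuotient_of_discrete _
  rw [← relIndex_map_eq (V.archToU21 hT) Γ₁ Γ hle (inf_ker_archToU21_eq_bot L V hT Γ hfree)]
  exact @natCard_fiber_orbitMap U21 Ball _ _ _ _ _ _ (Subgroup.map_mono hle)
    (normal_subgroupOf_map (V.archToU21 hT) Γ₁ Γ hle) (finiteIndex_subgroupOf_map (V.archToU21 hT) Γ₁ Γ hle)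
    hT2 (fun z => stabilizer_ball_eq_bot L V hT Γ hfree z) p

/-! ## §3  PerL: the ball pieces `Γ_H(bK₁b⁻¹)'\𝔹² → Γ_H(bK_fb⁻¹)'\𝔹²` -/

/-- The ball-covering record of one piece `b`: `Γ₁ = Γ_H(bK₁b⁻¹) ≤ Γ = Γ_H(bK_fb⁻¹)`, `[Γ : Γ₁] ∣ [K_f : K₁]`,
and `Γ₁'\𝔹² → Γ'\𝔹²` is a covering map all of whose fibres have exactly `[Γ : Γ₁]` points. -/
structure BallPieceCovering (K₁ Kf : Subgroup (Ufin L V.Hm)) (b : Ufin L V.Hm) : Prop where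
  le : congruenceLattice L V.Hm (MulAut.conj b • K₁) ≤ congruenceLattice L V.Hm (MulAut.conj b • Kf)
  relIndex_dvd : (congruenceLattice L V.Hm (MulAut.conj b • K₁)).relIndex
    (congruenceLattice L V.Hm (MulAut.conj b • Kf)) ∣ K₁.relIndex Kf
  isCoveringMap : IsCoveringMap (orbitMap ((congruenceLattice L V.Hm (MulAut.conj b • K₁)).map (V.archToU21 hT))
    ((congruenceLattice L V.Hm (MulAut.conj b • Kf)).map (V.archToU21 hT)) (Subgroup.map_mono le) (X := Ball))
  natCard_fiber : ∀ p : orbitRel.Quotient ((congruenceLattice L V.Hm (MulAut.conj b • Kf)).map (V.archToU21 hT)) Ball,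
    Nat.card (orbitMap ((congruenceLattice L V.Hm (MulAut.conj b • K₁)).map (V.archToU21 hT))
      ((congruenceLattice L V.Hm (MulAut.conj b • Kf)).map (V.archToU21 hT)) (Subgroup.map_mono le)
      (X := Ball) ⁻¹' {p}) =
      (congruenceLattice L V.Hm (MulAut.conj b • K₁)).relIndex (congruenceLattice L V.Hm (MulAut.conj b • Kf))

/-- **PerL v5 ll. 74–75 ON THE BALL.**  For a hermitian 3-space `V`, a Sylvester frame `T` at `w₁` and a compact
open level `K_f ≤ K_H(3)`: there is an open compact `K₁ ≤ K_f` with `K₁ ≤ K_H(3)`, normal of finite index in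
`K_f`, such that for EVERY `b ∈ G_U(𝔸_f)` the map of ball quotients `Γ_H(bK₁b⁻¹)'\𝔹² → Γ_H(bK_fb⁻¹)'\𝔹²`
(`Γ' = archToU21 (Γ) ≤ U(2,1)`) is a COVERING MAP all of whose fibres have exactly
`[Γ_H(bK_fb⁻¹) : Γ_H(bK₁b⁻¹)]` points, a divisor of `[K_f : K₁]`. -/
theorem _root_.HodgeCM.HermSpace3.exists_ballPieces_isCoveringMap (Kf : Subgroup (Ufin L V.Hm))
    (hKo : IsOpen (Kf : Set (Ufin L V.Hm))) (hKc : IsCompact (Kf : Set (Ufin L V.Hm)))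
    (hK3 : Kf ≤ levelUfin L V.Hm 3) :
    ∃ K₁ : Subgroup (Ufin L V.Hm), K₁ ≤ Kf ∧ K₁ ≤ levelUfin L V.Hm 3 ∧ IsOpen (K₁ : Set (Ufin L V.Hm)) ∧
      IsCompact (K₁ : Set (Ufin L V.Hm)) ∧ (K₁.subgroupOf Kf).Normal ∧ (K₁.subgroupOf Kf).FiniteIndex ∧
      ∀ b : Ufin L V.Hm, BallPieceCovering L V hT K₁ Kf b := by
  obtain ⟨K₁, h1f, h13, hK1o, hK1c, hN, hFI, hg⟩ :=
    HodgeCM.PerL34.Godement.exists_torsionFree_normal_tower L V.Hm Kf hKo hKc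
  refine ⟨K₁, h1f, h13, hK1o, hK1c, hN, hFI, fun b => ?_⟩
  obtain ⟨hle, hNb, hFIb, hdvd, -⟩ := hg b
  haveI : DiscreteTopology (congruenceLattice L V.Hm (MulAut.conj b • K₁)) :=
    HodgeCM.HermSpace3.discreteTopology_congruenceLattice L V _ (isCompact_conj_smul K₁ hK1c b)
  haveI : DiscreteTopology (congruenceLattice L V.Hm (MulAut.conj b • Kf)) :=
    HodgeCM.HermSpace3.discreteTopology_congruenceLattice L V _ (isCompact_conj_smul Kf hKc b)
  have hfree : ∀ q : Uinf L V.Hm ⧸ V.archK T,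
      MulAction.stabilizer (Uinf L V.Hm) q ⊓ congruenceLattice L V.Hm (MulAut.conj b • Kf) = ⊥ := fun q =>
    stabilizer_inf_eq_bot_of_torsionFree _
      (HodgeCM.PerL34.Godement.torsionFree_congruenceLattice_conj L le_rfl hK3 b) (V.archK T)
      (V.isCompact_archK T) q
  exact
    { le := hle
      relIndex_dvd := hdvd
      isCoveringMap := isCoveringMap_ballOrbitMap L V hT _ _ hle hNb hFIb hfree
      natCard_fiber := natCard_fiber_ballOrbitMap L V hT _ _ hle hNb hFIb hfree }

end PerLBall

end HodgeCM.PerL34.ArchCompactK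

end

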